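import Mathlib.Analysis.Calculus.InverseFunctionTheorem.ContDiff
import Literature.AlgebraicGeometry.HodgeTheory.HypersurfaceResidueFormNonzero
import HarnessLib

/-!
# Holomorphic functions on an embedded hypersurface model extend locally along the affine coordinates

Holomorphic functions on the chart domains `M_i = ψ⁻¹(U_i)` of an embedded hypersurface model, read through the affine
coordinates `u_i = (x_j/x_i)_{j ≠ i}` (`affineCoord ψ i`), are locally restrictions of holomorphic functions of the ambient
affine space. The setting is a general embedded hypersurface
model (`HypersurfaceResidueFormDef`: `ψ : M → ℙ(ℂ^{m+2})` a topological embedding into `V(F)` with holomorphic affine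
coordinates, `F` with non-vanishing gradient on its cone, `dim_ℂ E = m`):

* `exists_differentiableOn_comp_eq_of_injective_fderiv` — **local holomorphic extension along an immersion** (normed spaces):
  if `h : E → F` is holomorphic near `c₀` with injective differential there and `u` is holomorphic near `c₀`, there is a
  holomorphic `G` on an open `W ∋ h c₀` with `G (h e) = u e` for `e` near `c₀`. Mechanism: complete `dh(c₀)` by a complement `K`
  of its range to an isomorphism `E × K ≅ F`, invert `Ψ(e, k) = h e + k` locally (Mathlib's inverse function theorem,
  `ContDiffAt.toOpenPartialHomeomorph`, analytic case), and put `G = u ∘ pr₁ ∘ Ψ⁻¹`.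
* `exists_differentiableOn_comp_affineCoord_eq` — **on the model**: for `x₀ ∈ M_{i₀}` and `f` complex-differentiable at the
  points of `M_{i₀}`, there is a holomorphic `G` on an open `W ∋ u_{i₀}(x₀)` of `ℂ^{m+1}` with `G (u_{i₀} x) = f x` for EVERY
  `x ∈ M_{i₀}` with `u_{i₀} x ∈ W` (the differential of `u_{i₀}` in a chart is injective by `injective_liftDeriv` — Clements–Osgood
  — and `u_{i₀}|_{M_{i₀}}` is a topological embedding, so `W` can be shrunk to see only points near `x₀`).
* `injOn_affineCoord`, `affineCoord_image_liftDomain` — `u_{i₀}` is injective on `M_{i₀}` with image the affine hypersurface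
  `{y | F(y₀, …, 1, …, y_m) = 0}` when `range ψ = V(F)`.

(Fritzsche–Grauert, *From Holomorphic Functions to Complex Manifolds*, Ch. I §8 and Ch. IV §1: holomorphic functions on an
embedded submanifold are locally restrictions of holomorphic functions of the ambient space.)

Provenance: Literature home (namespace `Literature.AlgebraicGeometry.HodgeTheory.HypersurfaceTopForms`) of the Summits-side `Theorems/CyclicUnitaryPowersAffineCoordExtension` (cell `hodge-nonav`, programme PG-GENERAL, prover seat `hodge-nonav-prover-Bx` g11; all its imports are `Literature/` and Mathlib), part of the seven-file chain proving Griffiths' description of the holomorphic top forms of a smooth hypersurface (`h^{n,0}(X_F) = C(d-1, n+1)`); theorems only, no named fact, no definition. Lane `lit-hodgefound` (Layer A1: Hodge theory of hypersurfaces), seat p20.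
-/

noncomputable section

open scoped Manifold ContDiff _root_.Topology _root_.LinearAlgebra.Projectivization
open Set Filter Function Projectivization

namespace Literature.AlgebraicGeometry.HodgeTheory.HypersurfaceTopForms.AffineCoordExtension

open Literature.AlgebraicGeometry.HodgeTheory Literature.NumberTheory.Transcendental Literature.Geometry.Kaehler

section NormedSpace

variable {E : Type*} [NormedAddCommGroup E] [NormedSpace ℂ E] [FiniteDimensional ℂ E]
  {F : Type*} [NormedAddCommGroup F] [NormedSpace ℂ F] [FiniteDimensional ℂ F]

/-- **Local holomorphic extension along an immersion.** Let `h : E → F` be complex-differentiable on an open `S ∋ c₀`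
between finite-dimensional spaces with `dh(c₀)` injective, and `u : E → ℂ` complex-differentiable on `S`. Then some
holomorphic `G` on an open `W ∋ h c₀` satisfies `G (h e) = u e` for all `e` near `c₀`. Proof: with `K` a complement of
`range dh(c₀)`, the map `Ψ(e, k) = h e + k` has invertible differential at `(c₀, 0)`, hence (inverse function theorem, analytic
case) an analytic local inverse; `G = u ∘ pr₁ ∘ Ψ⁻¹`. [cite: FritzscheGrauert2002, Ch. I §8 Thm. 8.5 and Ch. IV §1] -/
theorem exists_differentiableOn_comp_eq_of_injective_fderiv {S : Set E} (hS : IsOpen S) {c₀ : E} (hc₀ : c₀ ∈ S)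
    {h : E → F} (hh : DifferentiableOn ℂ h S) (hinj : Injective (fderiv ℂ h c₀)) {u : E → ℂ}
    (hu : DifferentiableOn ℂ u S) :
    ∃ W : Set F, IsOpen W ∧ h c₀ ∈ W ∧ ∃ G : F → ℂ, DifferentiableOn ℂ G W ∧ ∀ᶠ e in 𝓝 c₀, G (h e) = u e := by
  haveI : CompleteSpace F := FiniteDimensional.complete ℂ F
  haveI : CompleteSpace E := FiniteDimensional.complete ℂ E
  set L : E →L[ℂ] F := fderiv ℂ h c₀ with hL
  -- a complement `K` of `range L`
  obtain ⟨K, hK⟩ := Submodule.exists_isCompl (LinearMap.range (L : E →ₗ[ℂ] F))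
  -- `Ψ (e, k) = h e + k`, with differential `D (e, k) = L e + k` at `(c₀, 0)`
  set Ψ : E × K → F := fun q ↦ h q.1 + (q.2 : F) with hΨ
  set D : (E × K) →L[ℂ] F := L.coprod K.subtypeL with hD
  have hDinj : Injective D := by
    refine (injective_iff_map_eq_zero D).2 fun q hq ↦ ?_
    obtain ⟨e, k⟩ := q
    have hq' : L e + (k : F) = 0 := by simpa [hD] using hq
    have hLe : L e = -(k : F) := eq_neg_of_add_eq_zero_left hq'
    have hmem : L e ∈ K := by rw [hLe]; exact K.neg_mem k.2
    have hLe0 : L e = 0 :=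
      (Submodule.disjoint_def.1 hK.disjoint) _ (LinearMap.mem_range_self (L : E →ₗ[ℂ] F) e) hmem
    have he : e = 0 := hinj (by rw [hLe0, map_zero])
    have hk : (k : F) = 0 := by rw [hLe0, zero_add] at hq'; exact hq'
    ext
    · exact he
    · exact hk
  have hDsurj : Surjective D := by
    intro y
    have hy : y ∈ LinearMap.range (L : E →ₗ[ℂ] F) ⊔ K := by rw [hK.sup_eq_top]; exact Submodule.mem_top
    obtain ⟨a, ha, b, hb, hab⟩ := Submodule.mem_sup.1 hy
    obtain ⟨e, rfl⟩ := LinearMap.mem_range.1 ha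
    exact ⟨(e, ⟨b, hb⟩), by simpa [hD] using hab⟩
  set Deq : (E × K) ≃L[ℂ] F :=
    (LinearEquiv.ofBijective (D : (E × K) →ₗ[ℂ] F) ⟨hDinj, hDsurj⟩).toContinuousLinearEquiv with hDeq
  have hDeqD : (Deq : (E × K) →L[ℂ] F) = D := by
    apply ContinuousLinearMap.ext
    intro q
    rfl
  -- `h` is analytic at `c₀` (Osgood), so `Ψ` is analytic at `(c₀, 0)`
  have hhan : AnalyticAt ℂ h c₀ := Literature.Analysis.Complex.SCV.analyticAt_of_differentiableOn hh hS hc₀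
  have hΨan : AnalyticAt ℂ Ψ (c₀, 0) := by
    have h1 : AnalyticAt ℂ (fun q : E × K ↦ h q.1) (c₀, 0) := AnalyticAt.comp (by exact hhan) analyticAt_fst
    have h2 : AnalyticAt ℂ (fun q : E × K ↦ (q.2 : F)) (c₀, 0) := (K.subtypeL.analyticAt _).comp analyticAt_snd
    exact h1.add h2
  have hΨc : ContDiffAt ℂ ω Ψ (c₀, 0) := hΨan.contDiffAt
  have hΨD : HasFDerivAt Ψ D (c₀, 0) := by
    have h1 : HasFDerivAt (fun q : E × K ↦ h q.1) (L.comp (ContinuousLinearMap.fst ℂ E K)) (c₀, 0) :=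
      HasFDerivAt.comp ((c₀, (0 : K)) : E × K) (hhan.differentiableAt.hasFDerivAt) hasFDerivAt_fst
    have h2 : HasFDerivAt (fun q : E × K ↦ (q.2 : F)) (K.subtypeL.comp (ContinuousLinearMap.snd ℂ E K)) (c₀, 0) :=
      K.subtypeL.hasFDerivAt.comp _ hasFDerivAt_snd
    have h12 := h1.add h2
    rw [ContinuousLinearMap.comp_fst_add_comp_snd] at h12
    exact h12
  have hΨd : HasFDerivAt Ψ (Deq : (E × K) →L[ℂ] F) (c₀, 0) := by rw [hDeqD]; exact hΨD
  have hω : (ω : WithTop ℕ∞) ≠ 0 := by simp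
  set Φ := hΨc.toOpenPartialHomeomorph Ψ hΨd hω with hΦ
  have hΦcoe : (Φ : E × K → F) = Ψ := hΨc.toOpenPartialHomeomorph_coe hΨd hω
  have hsrc : ((c₀, (0 : K)) : E × K) ∈ Φ.source := hΨc.mem_toOpenPartialHomeomorph_source hΨd hω
  have hΨ0 : Ψ (c₀, 0) = h c₀ := by simp [hΨ]
  -- the inverse is analytic near `h c₀`
  have hinv : ContDiffAt ℂ ω Φ.symm (h c₀) := by
    have := hΨc.to_localInverse hΨd hω
    rw [hΨ0] at this
    exact this
  obtain ⟨W₁, hW₁sub, hW₁o, hW₁mem⟩ := mem_nhds_iff.mp (hinv.eventually (by simp))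
  have htgt : h c₀ ∈ Φ.target := by rw [← hΨ0, ← hΦcoe]; exact Φ.map_source hsrc
  have hsymm0 : Φ.symm (h c₀) = (c₀, 0) := by rw [← hΨ0, ← hΦcoe]; exact Φ.left_inv hsrc
  set W : Set F := W₁ ∩ (Φ.target ∩ Φ.symm ⁻¹' (Prod.fst ⁻¹' S)) with hW
  have hWo : IsOpen W :=
    hW₁o.inter (Φ.continuousOn_symm.isOpen_inter_preimage Φ.open_target (hS.preimage continuous_fst))
  refine ⟨W, hWo, ⟨hW₁mem, htgt, ?_⟩, fun y ↦ u (Φ.symm y).1, ?_, ?_⟩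
  · show (Φ.symm (h c₀)).1 ∈ S
    rw [hsymm0]; exact hc₀
  · intro y hy
    have h1 : DifferentiableAt ℂ Φ.symm y := by
      have hy1 : ContDiffAt ℂ ω Φ.symm y := hW₁sub hy.1
      exact hy1.differentiableAt hω
    have h2 : DifferentiableAt ℂ u (Φ.symm y).1 := (hu _ hy.2.2).differentiableAt (hS.mem_nhds hy.2.2)
    have h3 : DifferentiableAt ℂ (fun y ↦ (Φ.symm y).1) y := differentiableAt_fst.comp y h1
    exact (h2.comp y h3).differentiableWithinAt
  · have hev := Φ.eventually_left_inverse hsrc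
    have ht : Tendsto (fun e : E ↦ ((e, (0 : K)) : E × K)) (𝓝 c₀) (𝓝 (c₀, 0)) :=
      tendsto_id.prodMk_nhds tendsto_const_nhds
    filter_upwards [ht.eventually hev] with e he
    show u (Φ.symm (h e)).1 = u e
    have hhe : h e = Φ (e, 0) := by rw [hΦcoe]; simp [hΨ]
    rw [hhe, he]

end NormedSpace

section Model

variable {m : ℕ} {E : Type*} [NormedAddCommGroup E] [NormedSpace ℂ E] [FiniteDimensional ℂ E]
  {M : Type*} [TopologicalSpace M] [ChartedSpace E M] [IsManifold 𝓘(ℂ, E) ω M]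
  (ψ : M → ℙ ℂ (Fin (m + 2) → ℂ)) {F : MvPolynomial (Fin (m + 2)) ℂ} {d : ℕ}

omit [FiniteDimensional ℂ E] [IsManifold 𝓘(ℂ, E) ω M] [TopologicalSpace M] in
/-- **The affine coordinates are injective on their chart domain**: `u_{i₀} = stdChart_{i₀} ∘ ψ` with `ψ` injective and
the standard chart injective on `U_{i₀}`. [cite: FritzscheGrauert2002, Ch. I §8 Thm. 8.5 and Ch. IV §1] -/
theorem injOn_affineCoord (hψ : Injective ψ) (i₀ : Fin (m + 2)) :
    InjOn (affineCoord ψ i₀) (liftDomain ψ i₀) := fun _ hx _ hx' hxx' ↦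
  hψ ((stdChart i₀).injOn hx hx' hxx')

omit [FiniteDimensional ℂ E] [IsManifold 𝓘(ℂ, E) ω M] [TopologicalSpace M] in
/-- **The image of the chart domain under the affine coordinates is the affine hypersurface**
`{y | F(y₀, …, 1, …, y_m) = 0}` (the `1` in slot `i₀`), when `ψ` maps ONTO `V(F)` and `F` is homogeneous. [cite: FritzscheGrauert2002, Ch. I §8 Thm. 8.5 and Ch. IV §1] -/
theorem affineCoord_image_liftDomain (hF : F.IsHomogeneous d) (hrange : range ψ = projZeroLocus {F}) (i₀ : Fin (m + 2)) :
    affineCoord ψ i₀ '' liftDomain ψ i₀ = {y | MvPolynomial.eval (Fin.insertNth i₀ (1 : ℂ) y) F = 0} := by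
  ext y
  constructor
  · rintro ⟨x, hx, rfl⟩
    exact eval_projLift_eq_zero ψ hF hrange.le hx
  · intro hy
    have hP : stdChartInv i₀ y ∈ projZeroLocus {F} := by
      by_cases hF0 : F = 0
      · subst hF0
        simp [projZeroLocus]
      · have hS : ∀ G ∈ ({F} : Set (MvPolynomial (Fin (m + 2)) ℂ)), G.IsHomogeneous G.totalDegree := by
          rintro G rfl; rwa [hF.totalDegree hF0]
        rw [stdChartInv, mem_projZeroLocus_mk_iff hS]
        intro G hG
        rw [mem_singleton_iff.mp hG]
        exact hy
    rw [← hrange] at hP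
    obtain ⟨x, hx⟩ := hP
    have hxU : x ∈ liftDomain ψ i₀ := by
      rw [mem_liftDomain_iff, hx, stdChart_source, stdChartInv, mk_mem_stdChartSource_iff]
      simp
    refine ⟨x, hxU, ?_⟩
    show (stdChart i₀ : OpenPartialHomeomorph (ℙ ℂ (Fin (m + 2) → ℂ)) (Fin (m + 1) → ℂ)) (ψ x) = y
    rw [hx, stdChart_apply, stdChartFun_stdChartInv]

/-- **Local holomorphic extension along the affine coordinates of an embedded hypersurface model.** Let `F` be
homogeneous of degree `d` with non-vanishing gradient at its non-zero zeros, `ψ : M → ℙ(ℂ^{m+2})` a topological embedding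
into `V(F)` with holomorphic affine coordinates, `dim_ℂ E = m`. For `x₀ ∈ M_{i₀}` and `f : M → ℂ` complex-differentiable at
the points of `M_{i₀}`, there are an open `W ∋ u_{i₀}(x₀)` of `ℂ^{m+1}` and a holomorphic `G` on `W` with `G (u_{i₀} x) = f x`
for every `x ∈ M_{i₀}` with `u_{i₀} x ∈ W`. Proof: in the chart at `x₀` the differential of `u_{i₀}` is injective
(`injective_liftDeriv`, `liftDeriv_eq_finInsertCLM_comp`), so `exists_differentiableOn_comp_eq_of_injective_fderiv` gives `G`
near `x₀`; since `u_{i₀}|_{M_{i₀}}` is a topological embedding (`ψ` is, the standard chart is a homeomorphism), `W` shrinks to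
an open set meeting `u_{i₀}(M_{i₀})` only in the image of a neighbourhood of `x₀`. [cite: FritzscheGrauert2002, Ch. I §8 Thm. 8.5 and Ch. IV §1] -/
theorem exists_differentiableOn_comp_affineCoord_eq (hF : F.IsHomogeneous d) (hψ : Topology.IsEmbedding ψ)
    (hrange : range ψ ⊆ projZeroLocus {F})
    (hjac : ∀ z : Fin (m + 2) → ℂ, z ≠ 0 → MvPolynomial.eval z F = 0 →
      ∃ j, MvPolynomial.eval z (MvPolynomial.pderiv j F) ≠ 0)
    (hhol : HasHolomorphicCoords E ψ) (hdim : Module.finrank ℂ E = m)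
    {i₀ : Fin (m + 2)} {x₀ : M} (hx₀ : x₀ ∈ liftDomain ψ i₀) {f : M → ℂ}
    (hf : ∀ x ∈ liftDomain ψ i₀, MDifferentiableAt 𝓘(ℂ, E) 𝓘(ℂ, ℂ) f x) :
    ∃ W : Set (Fin (m + 1) → ℂ), IsOpen W ∧ affineCoord ψ i₀ x₀ ∈ W ∧ ∃ G : (Fin (m + 1) → ℂ) → ℂ,
      DifferentiableOn ℂ G W ∧ ∀ x ∈ liftDomain ψ i₀, affineCoord ψ i₀ x ∈ W → G (affineCoord ψ i₀ x) = f x := by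
  have hψc : Continuous ψ := hψ.continuous
  set φ := extChartAt 𝓘(ℂ, E) x₀ with hφ
  set c₀ : E := φ x₀ with hc₀
  have hsymm₀ : φ.symm c₀ = x₀ := extChartAt_to_inv x₀
  -- the chart-level data
  set S : Set E := φ.target ∩ φ.symm ⁻¹' liftDomain ψ i₀ with hS
  have hSo : IsOpen S := isOpen_target_inter_preimage_liftDomain ψ hψc i₀ x₀
  have hc₀S : c₀ ∈ S := ⟨mem_extChartAt_target x₀, by rw [mem_preimage, hsymm₀]; exact hx₀⟩
  set h : E → (Fin (m + 1) → ℂ) := affineCoord ψ i₀ ∘ φ.symm with hh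
  have hhS : DifferentiableOn ℂ h S := by
    have hZ := differentiableOn_projLift_comp_symm ψ hψc hhol i₀ x₀
    intro y hy
    have hcomp : h = fun y ↦ fun l ↦ (projLift ψ i₀ ∘ φ.symm) y (i₀.succAbove l) := by
      funext y; funext l
      simp only [hh, Function.comp_apply, projLift, Fin.insertNth_apply_succAbove]
    rw [hcomp]
    refine differentiableWithinAt_pi.mpr fun l ↦ ?_
    exact (differentiableAt_apply (𝕜 := ℂ) (i₀.succAbove l) ((projLift ψ i₀ ∘ φ.symm) y)).comp_differentiableWithinAt y
      (hZ y hy)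
  have hinj : Injective (fderiv ℂ h c₀) := by
    have hli := injective_liftDeriv ψ hF hψ hrange hjac hhol hdim hx₀
    rw [(liftDeriv_eq_finInsertCLM_comp ψ hψc hhol hx₀).1, ContinuousLinearMap.coe_comp] at hli
    exact Injective.of_comp hli
  set u : E → ℂ := f ∘ φ.symm with hu
  have huS : DifferentiableOn ℂ u S := by
    intro y hy
    have h1 : MDifferentiableAt 𝓘(ℂ, E) 𝓘(ℂ, ℂ) f (φ.symm y) := hf _ hy.2
    have h2 : MDifferentiableWithinAt 𝓘(ℂ, E) 𝓘(ℂ, E) φ.symm (range 𝓘(ℂ, E)) y :=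
      mdifferentiableWithinAt_extChartAt_symm hy.1
    have h3 := h1.comp_mdifferentiableWithinAt y h2
    rw [ModelWithCorners.Boundaryless.range_eq_univ, mdifferentiableWithinAt_univ,
      mdifferentiableAt_iff_differentiableAt] at h3
    exact h3.differentiableWithinAt
  -- the extension near `x₀`
  obtain ⟨W₀, hW₀o, hW₀mem, G, hG, hev⟩ := exists_differentiableOn_comp_eq_of_injective_fderiv hSo hc₀S hhS hinj huS
  have haff₀ : h c₀ = affineCoord ψ i₀ x₀ := by simp only [hh, Function.comp_apply, hsymm₀]
  -- transported to `M`: `G (u x) = f x` near `x₀`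
  have hevM : ∀ᶠ x in 𝓝 x₀, G (affineCoord ψ i₀ x) = f x := by
    have ht : Tendsto φ (𝓝 x₀) (𝓝 c₀) := continuousAt_extChartAt x₀
    filter_upwards [ht.eventually hev, extChartAt_source_mem_nhds (I := 𝓘(ℂ, E)) x₀] with x hx hxs
    have hxx : φ.symm (φ x) = x := φ.left_inv hxs
    simpa only [hh, hu, Function.comp_apply, hxx] using hx
  obtain ⟨V₁, hV₁sub, hV₁o, hx₀V₁⟩ := mem_nhds_iff.mp (inter_mem hevM ((isOpen_liftDomain ψ hψc i₀).mem_nhds hx₀))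
  -- `u_{i₀}|_{M_{i₀}}` is an embedding: an open `T` of `ℂ^{m+1}` cutting out `V₁`
  obtain ⟨O, hOo, hOV⟩ := hψ.isInducing.isOpen_iff.1 hV₁o
  set T : Set (Fin (m + 1) → ℂ) := (stdChart i₀ : OpenPartialHomeomorph (ℙ ℂ (Fin (m + 2) → ℂ)) (Fin (m + 1) → ℂ)).target ∩
    (stdChart i₀ : OpenPartialHomeomorph (ℙ ℂ (Fin (m + 2) → ℂ)) (Fin (m + 1) → ℂ)).symm ⁻¹' O with hT
  have hTo : IsOpen T := (stdChart i₀).isOpen_inter_preimage_symm hOo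
  have hmemT : ∀ x ∈ liftDomain ψ i₀, affineCoord ψ i₀ x ∈ T ↔ x ∈ V₁ := by
    intro x hx
    rw [← hOV, mem_preimage, hT]
    change (stdChart i₀ : OpenPartialHomeomorph (ℙ ℂ (Fin (m + 2) → ℂ)) (Fin (m + 1) → ℂ)) (ψ x) ∈ _ ↔ _
    rw [mem_inter_iff, mem_preimage, (stdChart i₀).left_inv hx]
    exact ⟨fun h ↦ h.2, fun h ↦ ⟨(stdChart i₀).map_source hx, h⟩⟩
  refine ⟨W₀ ∩ T, hW₀o.inter hTo, ⟨haff₀ ▸ hW₀mem, (hmemT x₀ hx₀).2 hx₀V₁⟩, G, hG.mono inter_subset_left,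
    fun x hx hxW ↦ ?_⟩
  exact (hV₁sub ((hmemT x hx).1 hxW.2)).1

/-- **The same, packaged for a function already transported to the affine coordinates** (the shape of hypothesis `hhol` of
`CyclicUnitaryPowersFermatAffineEigenfunctions.eqOn_zero_of_eigenfunction_of_growth`): if `g : ℂ^{m+1} → ℂ` agrees with `f`
through `u_{i₀}` on `M_{i₀}`, then at every point of `u_{i₀}(M_{i₀})` it is locally the restriction of a holomorphic function
of `ℂ^{m+1}`. [cite: FritzscheGrauert2002, Ch. I §8 Thm. 8.5 and Ch. IV §1] -/
theorem exists_differentiableOn_eqOn_image_affineCoord (hF : F.IsHomogeneous d) (hψ : Topology.IsEmbedding ψ)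
    (hrange : range ψ ⊆ projZeroLocus {F})
    (hjac : ∀ z : Fin (m + 2) → ℂ, z ≠ 0 → MvPolynomial.eval z F = 0 →
      ∃ j, MvPolynomial.eval z (MvPolynomial.pderiv j F) ≠ 0)
    (hhol : HasHolomorphicCoords E ψ) (hdim : Module.finrank ℂ E = m)
    {i₀ : Fin (m + 2)} {f : M → ℂ} (hf : ∀ x ∈ liftDomain ψ i₀, MDifferentiableAt 𝓘(ℂ, E) 𝓘(ℂ, ℂ) f x)
    {g : (Fin (m + 1) → ℂ) → ℂ} (hg : ∀ x ∈ liftDomain ψ i₀, g (affineCoord ψ i₀ x) = f x)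
    {y : Fin (m + 1) → ℂ} (hy : y ∈ affineCoord ψ i₀ '' liftDomain ψ i₀) :
    ∃ W : Set (Fin (m + 1) → ℂ), IsOpen W ∧ y ∈ W ∧ ∃ G : (Fin (m + 1) → ℂ) → ℂ, DifferentiableOn ℂ G W ∧
      ∀ y' ∈ W, y' ∈ affineCoord ψ i₀ '' liftDomain ψ i₀ → G y' = g y' := by
  obtain ⟨x₀, hx₀, rfl⟩ := hy
  obtain ⟨W, hWo, hW, G, hG, hGf⟩ := exists_differentiableOn_comp_affineCoord_eq ψ hF hψ hrange hjac hhol hdim hx₀ hf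
  refine ⟨W, hWo, hW, G, hG, fun y' hy'W hy' ↦ ?_⟩
  obtain ⟨x, hx, rfl⟩ := hy'
  rw [hGf x hx hy'W, hg x hx]

end Model

end Literature.AlgebraicGeometry.HodgeTheory.HypersurfaceTopForms.AffineCoordExtension

end
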